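import Summits.HubbardSuperconductivity.HubbardSuperconductivity.Theorems.WeakCouplingBCSKlLindhardEnclosureStraddle
import Summits.HubbardSuperconductivity.HubbardSuperconductivity.Theorems.WeakCouplingBCSKlLindhardEnclosureLogBounds
import Summits.HubbardSuperconductivity.HubbardSuperconductivity.Theorems.WeakCouplingBCSKlLindhardEnclosureTipRecords

/-!
# KL-MARGIN-SCAN reader (22) «kernel-lindhard-enclosure» — boundary FLOOR rule: the cosine-space minorant and the per-piece log floor

Physics/kernel side of the oriented boundary-floor rule `FloorBdrySoundOrd` (the last open rule predicate of the (22) instrument), to be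
fed into the kernel-agnostic `…FloorCore.floor2D_core`:
* §1 the (a, b)-MINORANT `fminR t μ far W a b = 𝟙[occupations differ] / (W + |ε(a,b) − μ|)` (`W ≥ sup |ε_far − μ|` on the cell):
  non-negative, `≤ 1/W`, jointly measurable; and it minorises the two-shell integrand through the straddler's cosines on every guarded
  single-straddle cell (`Params.fminR_le_integrand_sh/_nsh`, from the closed-cell band enclosures, status soundness and p4's
  `abs_sub_mu_le_distHiZ`);
* §2 on an abscissa piece where `0 < S(a) ≤ S₁` and `βm ≤ b⋆(a) ≤ β0` (occupied crescent) the minorant is `≥ 1/(S₁(b − βm) + W)` for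
  `b > b⋆(a)`, whence `∫_{[βI0,βI1]} fminR ≥ S₁⁻¹ log((S₁(β1 − βm) + W)/(S₁(β0 − βm) + W))` (`…Subst.integral_inv_affine`); the empty
  crescent symmetrically;
(The kernel's integer pieces `bdryPieceLo` against these floors: `…FloorPieceLo`.)
Honest framing: elementary analysis over the landed kernel; nothing in this file asserts a KL margin at any `t′ ≠ 0`, `K₃`, `U₀`, the window
or B1g dominance; a Kohn–Luttinger instability statement is not ODLRO and nothing here proves superconductivity in the Hubbard model.
(p1 g26, 2026-08-29.)
-/

noncomputable section

set_option linter.dupNamespace false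

namespace Summit.HubbardSuperconductivity.HubbardSuperconductivity.Theorems.KlLindhardEnclosure

open Real Set MeasureTheory Literature.MathematicalPhysics.QuantumLattice
open Summit.HubbardSuperconductivity.HubbardSuperconductivity.Theorems
open Summit.HubbardSuperconductivity.HubbardSuperconductivity.Theorems.KlStair (bandR)

/-! ## §1 The cosine-space minorant -/

/-- The `(a, b)`-minorant of the two-shell integrand on a single-straddle cell whose far point has occupation `far` and
`|ε_far − μ| ≤ W`: `0` where the straddler's occupation agrees with `far`, else `1/(W + |ε(a, b) − μ|)`. [folklore] -/
def fminR (t μ : ℝ) (far : Bool) (W a b : ℝ) : ℝ :=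
  if (bandR t a b < μ ↔ far = true) then 0 else 1 / (W + |bandR t a b - μ|)

/-- `fminR ≥ 0` (`W > 0`). -/
theorem fminR_nonneg (t μ : ℝ) (far : Bool) {W : ℝ} (hW : 0 < W) (a b : ℝ) : 0 ≤ fminR t μ far W a b := by
  unfold fminR
  split_ifs
  · exact le_rfl
  · positivity

/-- `fminR ≤ 1/W` (`W > 0`). -/
theorem fminR_le (t μ : ℝ) (far : Bool) {W : ℝ} (hW : 0 < W) (a b : ℝ) : fminR t μ far W a b ≤ 1 / W := by
  unfold fminR
  split_ifs
  · positivity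
  · exact one_div_le_one_div_of_le hW (by linarith [abs_nonneg (bandR t a b - μ)])

/-- `fminR` is jointly measurable in `(a, b)`. -/
theorem measurable_fminR (t μ : ℝ) (far : Bool) (W : ℝ) : Measurable (Function.uncurry (fminR t μ far W)) := by
  have e : Function.uncurry (fminR t μ far W) = fun p : ℝ × ℝ =>
      if (-2 * (p.1 + p.2) - 4 * t * p.1 * p.2 < μ ↔ far = true) then 0
      else 1 / (W + |-2 * (p.1 + p.2) - 4 * t * p.1 * p.2 - μ|) := by
    funext p; rfl
  rw [e]
  refine Measurable.ite ?_ measurable_const (by fun_prop)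
  cases far
  · simp only [Bool.false_eq_true, iff_false, not_lt]
    exact measurableSet_le measurable_const (by fun_prop)
  · simp only [iff_true]
    exact measurableSet_lt (by fun_prop) measurable_const

/-- Shape lemma: the pointwise comparison `fminR ≤ two-shell value`. -/
theorem fminR_le_twoShell {t μ W ef : ℝ} (far : Bool) (a b : ℝ) (hW : |ef - μ| ≤ W) (hfar : ef < μ ↔ far = true) :
    fminR t μ far W a b ≤
      (if (ef < μ) = (bandR t a b < μ) then (0 : ℝ) else 1 / (|ef - μ| + |bandR t a b - μ|)) := by
  unfold fminR
  set es := bandR t a b with hes_def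
  by_cases h1 : (es < μ ↔ far = true)
  · rw [if_pos h1]
    split_ifs
    · exact le_rfl
    · positivity
  · rw [if_neg h1]
    have hne : ¬ ((ef < μ) = (es < μ)) := fun heq => h1 ((Iff.of_eq heq).symm.trans hfar)
    rw [if_neg hne]
    have hpos : 0 < |ef - μ| + |es - μ| := by
      by_contra hle
      push Not at hle
      have h0 : |ef - μ| = 0 := by linarith [abs_nonneg (ef - μ), abs_nonneg (es - μ)]
      have h0' : |es - μ| = 0 := by linarith [abs_nonneg (ef - μ), abs_nonneg (es - μ)]
      have hef : ef = μ := by have := abs_eq_zero.mp h0; linarith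
      have hes : es = μ := by have := abs_eq_zero.mp h0'; linarith
      exact hne (by rw [hef, hes])
    exact one_div_le_one_div_of_le hpos (by linarith)

/-- **DOMINATION FROM BELOW, straddler `p + q` (`sh = true`)**: on a guarded cell inside the root square whose point `p` has certified
status `far`, `fminR t′ μ far (distHiZ(e1)/2^40) (cos (x + q₁/U)) (cos (y + q₂/U)) ≤ F (pt x y)`. -/
theorem Params.fminR_le_integrand_sh (P : Params) (hP : P.admissible = true) {a b c d : ℤ} (hin : P.InRoot a b c d) (far : Bool)
    (hg : (P.cell (P.mkX a) (P.mkX b) (P.mkY c) (P.mkY d)).guards = true)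
    (hs1 : P.status (P.cell (P.mkX a) (P.mkX b) (P.mkY c) (P.mkY d)).e1Lo (P.cell (P.mkX a) (P.mkX b) (P.mkY c) (P.mkY d)).e1Hi = some far)
    {x y : ℝ} (hx : x ∈ Icc ((a : ℝ) / (P.U : ℝ)) ((b : ℝ) / (P.U : ℝ))) (hy : y ∈ Icc ((c : ℝ) / (P.U : ℝ)) ((d : ℝ) / (P.U : ℝ))) :
    fminR ((P.tpN : ℝ) / (P.tpD : ℝ)) ((P.muN : ℝ) / (P.muD : ℝ)) far
      (((P.distHiZ (P.cell (P.mkX a) (P.mkX b) (P.mkY c) (P.mkY d)).e1Lo (P.cell (P.mkX a) (P.mkX b) (P.mkY c) (P.mkY d)).e1Hi : ℤ) : ℝ) / 2 ^ 40)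
      (Real.cos (x + (P.q1z : ℝ) / (P.U : ℝ))) (Real.cos (y + (P.q2z : ℝ) / (P.U : ℝ))) ≤ P.integrand (pt x y) := by
  obtain ⟨-, hmuD, -, -, -⟩ := P.admissible_facts hP
  obtain ⟨e1l, e1h⟩ := P.cell_band_mem_Icc hP hin hg hx hy
  have hW := P.abs_sub_mu_le_distHiZ hmuD e1l e1h
  have hfar : (P.band (pt x y) < (P.muN : ℝ) / (P.muD : ℝ)) ↔ far = true := by
    rw [← P.cast_mu]
    cases far with
    | true => exact ⟨fun _ => rfl, fun _ => lt_of_le_of_lt e1h (P.status_true_lt hmuD hs1)⟩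
    | false => exact ⟨fun h => absurd h (not_lt.mpr ((P.status_false_le hmuD hs1).trans e1l)), fun h => by simp at h⟩
  rw [P.integrand_eq_ite, P.band_pt_shift, P.cast_mu]
  exact fminR_le_twoShell far _ _ hW hfar

/-- **DOMINATION FROM BELOW, straddler `p` (`sh = false`)**: `p + q` has certified status `far`;
`fminR t′ μ far (distHiZ(e2)/2^40) (cos x) (cos y) ≤ F (pt x y)`. -/
theorem Params.fminR_le_integrand_nsh (P : Params) (hP : P.admissible = true) {a b c d : ℤ} (hin : P.InRoot a b c d) (far : Bool)
    (hg : (P.cell (P.mkX a) (P.mkX b) (P.mkY c) (P.mkY d)).guards = true)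
    (hs2 : P.status (P.cell (P.mkX a) (P.mkX b) (P.mkY c) (P.mkY d)).e2Lo (P.cell (P.mkX a) (P.mkX b) (P.mkY c) (P.mkY d)).e2Hi = some far)
    {x y : ℝ} (hx : x ∈ Icc ((a : ℝ) / (P.U : ℝ)) ((b : ℝ) / (P.U : ℝ))) (hy : y ∈ Icc ((c : ℝ) / (P.U : ℝ)) ((d : ℝ) / (P.U : ℝ))) :
    fminR ((P.tpN : ℝ) / (P.tpD : ℝ)) ((P.muN : ℝ) / (P.muD : ℝ)) far
      (((P.distHiZ (P.cell (P.mkX a) (P.mkX b) (P.mkY c) (P.mkY d)).e2Lo (P.cell (P.mkX a) (P.mkX b) (P.mkY c) (P.mkY d)).e2Hi : ℤ) : ℝ) / 2 ^ 40)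
      (Real.cos (x + 0)) (Real.cos (y + 0)) ≤ P.integrand (pt x y) := by
  obtain ⟨-, hmuD, -, -, -⟩ := P.admissible_facts hP
  obtain ⟨e2l, e2h⟩ := P.cell_band_shift_mem_Icc hP hin hg hx hy
  have hW := P.abs_sub_mu_le_distHiZ hmuD e2l e2h
  have hfar : (P.band (pt x y + P.qv) < (P.muN : ℝ) / (P.muD : ℝ)) ↔ far = true := by
    rw [← P.cast_mu]
    cases far with
    | true => exact ⟨fun _ => rfl, fun _ => lt_of_le_of_lt e2h (P.status_true_lt hmuD hs2)⟩
    | false => exact ⟨fun h => absurd h (not_lt.mpr ((P.status_false_le hmuD hs2).trans e2l)), fun h => by simp at h⟩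
  rw [add_zero, add_zero, P.integrand_eq_ite_symm, P.band_pt, P.cast_mu]
  exact fminR_le_twoShell far _ _ hW hfar

/-! ## §2 The per-piece log floor -/

/-- Occupied crescent (`far = false`): for `0 < S(a) ≤ S₁`, `βm ≤ b⋆(a) < b`, `fminR ≥ 1/(S₁(b − βm) + W)`. -/
theorem fminR_ge_occ {t μ W S1 βm a b : ℝ} (hS : 0 < slopeS t a) (hS1 : slopeS t a ≤ S1) (hW : 0 < W)
    (hβm : βm ≤ bStar t μ a) (hb : bStar t μ a < b) :
    1 / (S1 * (b - βm) + W) ≤ fminR t μ false W a b := by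
  have hlt : bandR t a b < μ := (band_lt_iff_bStar_lt hS).mpr hb
  have hkey := mu_sub_band_eq (tp := t) (μ := μ) (a := a) (b := b) hS
  unfold fminR
  rw [if_neg (by simp [hlt])]
  have e : |bandR t a b - μ| = slopeS t a * (b - bStar t μ a) := by
    rw [abs_of_neg (by linarith)]; linarith
  rw [e]
  have h1 : slopeS t a * (b - bStar t μ a) ≤ S1 * (b - βm) :=
    mul_le_mul hS1 (by linarith) (by linarith) (by linarith)
  exact one_div_le_one_div_of_le (add_pos_of_pos_of_nonneg hW (mul_nonneg hS.le (by linarith))) (by linarith)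

/-- Empty crescent (`far = true`): for `0 < S(a) ≤ S₁`, `b < b⋆(a) ≤ βM`, `fminR ≥ 1/(S₁(βM − b) + W)`. -/
theorem fminR_ge_emp {t μ W S1 βM a b : ℝ} (hS : 0 < slopeS t a) (hS1 : slopeS t a ≤ S1) (hW : 0 < W)
    (hβM : bStar t μ a ≤ βM) (hb : b < bStar t μ a) :
    1 / (S1 * (βM - b) + W) ≤ fminR t μ true W a b := by
  have hnl : ¬ bandR t a b < μ := fun h => by have := (band_lt_iff_bStar_lt hS).mp h; linarith
  have hkey := mu_sub_band_eq (tp := t) (μ := μ) (a := a) (b := b) hS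
  unfold fminR
  rw [if_neg (by simp [hnl])]
  have e : |bandR t a b - μ| = slopeS t a * (bStar t μ a - b) := by
    rw [abs_of_nonneg (by nlinarith)]; linarith
  rw [e]
  have h1 : slopeS t a * (bStar t μ a - b) ≤ S1 * (βM - b) :=
    mul_le_mul hS1 (by linarith) (by linarith) (by linarith)
  exact one_div_le_one_div_of_le (add_pos_of_pos_of_nonneg hW (mul_nonneg hS.le (by linarith))) (by linarith)

/-- `fminR t μ far W a` is integrable on every set of finite measure (`W > 0`). -/
theorem integrableOn_fminR (t μ : ℝ) (far : Bool) {W : ℝ} (hW : 0 < W) (a : ℝ) {s : Set ℝ} (hs : volume s ≠ ⊤) :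
    IntegrableOn (fminR t μ far W a) s volume :=
  Measure.integrableOn_of_bounded hs
    ((measurable_fminR t μ far W).comp (by fun_prop : Measurable fun v : ℝ => (a, v))).aestronglyMeasurable
    (Filter.Eventually.of_forall fun v => by
      change ‖fminR t μ far W a v‖ ≤ 1 / W
      rw [Real.norm_of_nonneg (fminR_nonneg t μ far hW a v)]; exact fminR_le t μ far hW a v)

/-- **OCCUPIED-CRESCENT LOG FLOOR**: `0 < S(a) ≤ S₁`, `βm ≤ b⋆(a) ≤ β0 ≤ β1`, `[β0, β1] ⊆ [βI0, βI1]` ⇒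
`S₁⁻¹ log((S₁(β1 − βm) + W)/(S₁(β0 − βm) + W)) ≤ ∫_{[βI0,βI1]} fminR t μ false W a`. -/
theorem inner_integral_ge_occ {t μ W S1 βm β0 β1 βI0 βI1 a : ℝ} (hS : 0 < slopeS t a) (hS1 : slopeS t a ≤ S1) (hW : 0 < W)
    (hβm : βm ≤ bStar t μ a) (hb0 : bStar t μ a ≤ β0) (h01 : β0 ≤ β1) (hI0 : βI0 ≤ β0) (hI1 : β1 ≤ βI1) :
    S1⁻¹ * Real.log ((S1 * (β1 - βm) + W) / (S1 * (β0 - βm) + W)) ≤ ∫ v in Icc βI0 βI1, fminR t μ false W a v := by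
  have hS1p : 0 < S1 := lt_of_lt_of_le hS hS1
  have hpos : 0 < S1 * (β0 - βm) + W := add_pos_of_nonneg_of_pos (mul_nonneg hS1p.le (by linarith)) hW
  -- shrink to `[β0, β1]`
  have h1 : ∫ v in Icc β0 β1, fminR t μ false W a v ≤ ∫ v in Icc βI0 βI1, fminR t μ false W a v :=
    setIntegral_mono_set (integrableOn_fminR t μ false hW a (measure_Icc_lt_top (μ := volume)).ne)
      (Filter.Eventually.of_forall fun v => fminR_nonneg t μ false hW a v)
      (Filter.Eventually.of_forall (Icc_subset_Icc hI0 hI1))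
  -- compare with the explicit minorant on `(β0, β1)`
  have hci : IntervalIntegrable (fun v => 1 / (S1 * (v - βm) + W)) volume β0 β1 := by
    refine ContinuousOn.intervalIntegrable ?_
    rw [uIcc_of_le h01]
    exact continuousOn_const.div (by fun_prop) fun v hv => ne_of_gt (add_pos_of_nonneg_of_pos (mul_nonneg hS1p.le (by linarith [hv.1])) hW)
  have hgi : IntervalIntegrable (fminR t μ false W a) volume β0 β1 :=
    (intervalIntegrable_iff_integrableOn_Icc_of_le h01).mpr (integrableOn_fminR t μ false hW a (measure_Icc_lt_top (μ := volume)).ne)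
  have hae : (fun v => 1 / (S1 * (v - βm) + W)) ≤ᵐ[volume.restrict (Icc β0 β1)] fminR t μ false W a := by
    have h' : ∀ᵐ v ∂(volume.restrict (Ioo β0 β1)), 1 / (S1 * (v - βm) + W) ≤ fminR t μ false W a v :=
      (ae_restrict_iff' measurableSet_Ioo).mpr (Filter.Eventually.of_forall fun v hv =>
        fminR_ge_occ hS hS1 hW hβm (lt_of_le_of_lt hb0 hv.1))
    rw [Measure.restrict_congr_set Ioo_ae_eq_Icc] at h'
    exact h'
  have h2 := intervalIntegral.integral_mono_ae_restrict h01 hci hgi hae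
  rw [integral_inv_affine hS1p hpos h01, intervalIntegral.integral_of_le h01, ← integral_Icc_eq_integral_Ioc] at h2
  exact h2.trans h1

/-- **EMPTY-CRESCENT LOG FLOOR**: `0 < S(a) ≤ S₁`, `β0 ≤ β1 ≤ b⋆(a) ≤ βM`, `[β0, β1] ⊆ [βI0, βI1]` ⇒
`S₁⁻¹ log((S₁(βM − β0) + W)/(S₁(βM − β1) + W)) ≤ ∫_{[βI0,βI1]} fminR t μ true W a`. -/
theorem inner_integral_ge_emp {t μ W S1 βM β0 β1 βI0 βI1 a : ℝ} (hS : 0 < slopeS t a) (hS1 : slopeS t a ≤ S1) (hW : 0 < W)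
    (hβM : bStar t μ a ≤ βM) (hb1 : β1 ≤ bStar t μ a) (h01 : β0 ≤ β1) (hI0 : βI0 ≤ β0) (hI1 : β1 ≤ βI1) :
    S1⁻¹ * Real.log ((S1 * (βM - β0) + W) / (S1 * (βM - β1) + W)) ≤ ∫ v in Icc βI0 βI1, fminR t μ true W a v := by
  have hS1p : 0 < S1 := lt_of_lt_of_le hS hS1
  have hpos : 0 < S1 * (-β1 - -βM) + W := add_pos_of_nonneg_of_pos (mul_nonneg hS1p.le (by linarith)) hW
  have h1 : ∫ v in Icc β0 β1, fminR t μ true W a v ≤ ∫ v in Icc βI0 βI1, fminR t μ true W a v :=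
    setIntegral_mono_set (integrableOn_fminR t μ true hW a (measure_Icc_lt_top (μ := volume)).ne)
      (Filter.Eventually.of_forall fun v => fminR_nonneg t μ true hW a v)
      (Filter.Eventually.of_forall (Icc_subset_Icc hI0 hI1))
  have hci : IntervalIntegrable (fun v => 1 / (S1 * (βM - v) + W)) volume β0 β1 := by
    refine ContinuousOn.intervalIntegrable ?_
    rw [uIcc_of_le h01]
    exact continuousOn_const.div (by fun_prop) fun v hv => ne_of_gt (add_pos_of_nonneg_of_pos (mul_nonneg hS1p.le (by linarith [hv.2])) hW)
  have hgi : IntervalIntegrable (fminR t μ true W a) volume β0 β1 :=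
    (intervalIntegrable_iff_integrableOn_Icc_of_le h01).mpr (integrableOn_fminR t μ true hW a (measure_Icc_lt_top (μ := volume)).ne)
  have hae : (fun v => 1 / (S1 * (βM - v) + W)) ≤ᵐ[volume.restrict (Icc β0 β1)] fminR t μ true W a := by
    have h' : ∀ᵐ v ∂(volume.restrict (Ioo β0 β1)), 1 / (S1 * (βM - v) + W) ≤ fminR t μ true W a v :=
      (ae_restrict_iff' measurableSet_Ioo).mpr (Filter.Eventually.of_forall fun v hv =>
        fminR_ge_emp hS hS1 hW hβM (lt_of_lt_of_le hv.2 hb1))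
    rw [Measure.restrict_congr_set Ioo_ae_eq_Icc] at h'
    exact h'
  have h2 := intervalIntegral.integral_mono_ae_restrict h01 hci hgi hae
  -- the explicit integral by the reflection `v ↦ −v`
  have h3 : (∫ v in β0..β1, 1 / (S1 * (βM - v) + W)) = ∫ u in (-β1)..(-β0), 1 / (S1 * (u - -βM) + W) := by
    rw [← intervalIntegral.integral_comp_neg]
    refine intervalIntegral.integral_congr fun v _ => ?_
    show 1 / (S1 * (βM - v) + W) = 1 / (S1 * (-v - -βM) + W)
    ring
  rw [h3, integral_inv_affine hS1p hpos (by linarith), intervalIntegral.integral_of_le h01, ← integral_Icc_eq_integral_Ioc] at h2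
  have e1 : S1 * (-β0 - -βM) + W = S1 * (βM - β0) + W := by ring
  have e2 : S1 * (-β1 - -βM) + W = S1 * (βM - β1) + W := by ring
  rw [e1, e2] at h2
  exact h2.trans h1

end Summit.HubbardSuperconductivity.HubbardSuperconductivity.Theorems.KlLindhardEnclosure

end
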